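import Summits.NavierStokesRegularity.NavierStokesRegularity.Theorems.QuietScarPocketDoorUniformRadius

/-!
# QuietScarPocketDoorUniformRadiusUniform — door S31 «QuietScarPocketDoor» LEG F, plate PF-b″ with UNIFORM CONSTANTS
# (= plate F32a of ROUND-30 door S32 «CalmPocketDoor», nsreg-p1 g25 `r30/PLATE-AID-32.md` 6439ace1c538d9e1, in S31 vocabulary)

Seat nsreg-C26-p1 g4 (S-door lane, LEAD ns-s30-p1 g2; DIRECTOR-NS #209 (2)); `--supports stmt-NavierStokesRegularity-0056 --as helper`.

The tree's PF-b `TerminalUniformRadius` (`QuietScarPocketDoorUniformRadius`, p624616) reads `∀ x_c r a M P, ∀ (u,p), hyps →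
∃ ρ K η, …`: the tube height `ρ`, the bound `K` and the time window `η` may depend on the solution.  Its proof, however, builds
them from `(r, a, M, P)`, the constants of the quantitative interior regularity `NSBoundedHigherRegularityBounds_holds` (uniform
in `(u,p)` by statement) and the absolute constants `(ε₀, C₀, K)` of the unit core `unitFloatingSliceCore_holds` only.  This
file re-runs the two proofs with the existential quantifiers PULLED IN FRONT of `∀ x_c (u,p)`:

* `exists_fderiv_bound_near_top_uniform` — `∃ R₁ K₁` depending on `(r, a, M, P)` only: every classical `(u,p)` (`ν = 1`) on
  `(a,0) × B(x_c,4r)` with `‖u‖ ≤ M`, `|p| ≤ P` has `‖∇u(t,x)‖ ≤ K₁` on `(−R₁², 0) × B(x_c,3r)`;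
* `exists_uniform_terminalRadius_of_unitFloatingSliceCore`, `exists_uniform_terminalRadius` — `∃ ρ K η > 0` depending on
  `(r, a, M, P)` only: every such `(u,p)`, every centre `x_c`, every slice `t ∈ (−η, 0)`: `u(t)` extends holomorphically to
  the local complex tube over `B(x_c,2r)` of height `ρ` with the bound `K`.

This uniformity is what door S32's plate F32 (`ExteriorTraceTube`: tube data `(r₀, K₀)` depending on the class level only)
consumes; it also sharpens LEG F of door S31.  Proofs: verbatim those of p624616, constants first.

HONEST FRAME: quantitative interior analyticity bookkeeping in support of the S-door criteria (S31 / S32) on HYPOTHETICAL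
blow-up profiles; item 0056 `NoTypeII` and Navier–Stokes regularity are NOT proved and stay OPEN.
[BradshawGrujicKukavica2015 Thm. 2.3 and (4.9) p. 19; SereginSverak2009 §2 p. 8.]
-/

noncomputable section

set_option linter.dupNamespace false

open MeasureTheory Set Function Filter Metric Real
open _root_.Topology
open scoped ENNReal NNReal ContDiff Laplacian InnerProductSpace RealInnerProductSpace
open Literature.Analysis.FunctionSpaces.EuclideanSpace (complexify complexify_apply norm_complexify
  complexify_injective continuous_complexify)
open Literature.Analysis.FluidPDE

namespace Summit.NavierStokesRegularity.NavierStokesRegularity.Theorems.QuietScarPocketDoor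

/-- **Uniform gradient bound up to the top**: for `(r, a, M, P)` there are `R₁ > 0` (`R₁² < −a`) and `K₁ ≥ 0` such that EVERY
classical solution `(u,p)` (`ν = 1`, no force) on `(a,0) × B(x_c,4r)` with `‖u‖ ≤ M`, `|p| ≤ P` has `u(t)` differentiable with
`‖∇u(t,x)‖ ≤ K₁` for `t ∈ (−R₁², 0)`, `x ∈ B(x_c,3r)` (quantitative interior regularity on the cylinders `Q((0,x), R)`,
`R = min r √(−a/2)`; the constant of `NSBoundedHigherRegularityBounds_holds` is uniform in the solution).
[cite: SereginSverak2009, §2 p. 8] -/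
theorem exists_fderiv_bound_near_top_uniform {r a : ℝ} (M P : ℝ) (hr : 0 < r) (ha : a < 0) :
    ∃ R₁ K₁ : ℝ, 0 < R₁ ∧ R₁ ^ 2 < -a ∧ 0 ≤ K₁ ∧
      ∀ (xc : EuclideanSpace ℝ (Fin 3)) (u : ℝ → EuclideanSpace ℝ (Fin 3) → EuclideanSpace ℝ (Fin 3))
        (p : ℝ → EuclideanSpace ℝ (Fin 3) → ℝ),
        IsClassicalNSSolutionOnRegion (Ioo a 0 ×ˢ ball xc (4 * r)) 1 0 u p →
        (∀ t ∈ Ioo a 0, ∀ x ∈ ball xc (4 * r), ‖u t x‖ ≤ M) →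
        (∀ t ∈ Ioo a 0, ∀ x ∈ ball xc (4 * r), |p t x| ≤ P) →
        ∀ t ∈ Ioo (-R₁ ^ 2) 0, ∀ x ∈ ball xc (3 * r),
          DifferentiableAt ℝ (u t) x ∧ ‖fderiv ℝ (u t) x‖ ≤ K₁ := by
  -- the radius of the regularity cylinders
  set R : ℝ := min r (Real.sqrt (-a / 2)) with hR_def
  have hR0 : 0 < R := lt_min hr (Real.sqrt_pos.2 (by linarith))
  have hRr : R ≤ r := min_le_left _ _
  have hRa : R ^ 2 ≤ -a / 2 := by
    calc R ^ 2 ≤ (Real.sqrt (-a / 2)) ^ 2 := pow_le_pow_left₀ hR0.le (min_le_right _ _) 2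
      _ = -a / 2 := Real.sq_sqrt (by linarith)
  -- the pressure mass of a cylinder, uniform in the centre
  set Pm : ℝ≥0∞ := ENNReal.ofReal P ^ (3 / 2 : ℝ) *
    (volume (Ioo (-R ^ 2) (0 : ℝ)) * volume (ball (0 : EuclideanSpace ℝ (Fin 3)) R)) with hPm
  have hPm_fin : Pm ≠ ⊤ := by
    refine ENNReal.mul_ne_top (ENNReal.rpow_ne_top_of_nonneg (by norm_num) ENNReal.ofReal_ne_top)
      (ENNReal.mul_ne_top ?_ measure_ball_lt_top.ne)
    rw [Real.volume_Ioo]; exact ENNReal.ofReal_ne_top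
  obtain ⟨K₀, hK₀⟩ := NSBoundedHigherRegularityBounds_holds.exists_uniform_bound R M Pm.toNNReal
    (r := R / 2) ⟨by positivity, by linarith⟩ 1
  refine ⟨R / 2, max K₀ 0, by positivity, by nlinarith, le_max_right _ _, ?_⟩
  intro xc u p hsol hM hP t ht x hx
  have hO : IsOpen (Ioo a 0 ×ˢ ball xc (4 * r)) := isOpen_Ioo.prod isOpen_ball
  set z : ℝ × EuclideanSpace ℝ (Fin 3) := ((0 : ℝ), x) with hz
  -- the cylinder `Q(z,R)` lies in the region
  have hsub : parabolicCylinder R z ⊆ Ioo a 0 ×ˢ ball xc (4 * r) := by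
    intro w hw
    rw [mem_parabolicCylinder] at hw
    obtain ⟨⟨h1, h2⟩, h3⟩ := hw
    simp only [hz] at h1 h2 h3
    refine mk_mem_prod ⟨by linarith, by linarith⟩ ?_
    rw [mem_ball] at hx ⊢
    linarith [dist_triangle w.2 x xc]
  have hdist : IsDistributionalNSSolutionOn (parabolicCylinderOpens R z) 1 0 u p :=
    hsol.isDistributionalNSSolutionOn hO (by rw [coe_parabolicCylinderOpens]; exact hsub)
  have hbd : ∀ᵐ w ∂(volume.restrict (parabolicCylinder R z)), ‖u w.1 w.2‖ ≤ M := by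
    refine (ae_restrict_iff' (isOpen_parabolicCylinder R z).measurableSet).2
      (Eventually.of_forall fun w hw => ?_)
    have hw' := mem_prod.1 (hsub hw)
    exact hM w.1 hw'.1 w.2 hw'.2
  have hpm : ∫⁻ w in parabolicCylinder R z, ‖p w.1 w.2‖ₑ ^ (3 / 2 : ℝ) ≤ (Pm.toNNReal : ℝ≥0∞) := by
    rw [ENNReal.coe_toNNReal hPm_fin, hPm]
    have hvol : volume (parabolicCylinder R z) =
        volume (Ioo (-R ^ 2) (0 : ℝ)) * volume (ball (0 : EuclideanSpace ℝ (Fin 3)) R) := by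
      rw [parabolicCylinder, Measure.volume_eq_prod, Measure.prod_prod, Measure.addHaar_ball_center]
      simp [hz]
    calc ∫⁻ w in parabolicCylinder R z, ‖p w.1 w.2‖ₑ ^ (3 / 2 : ℝ)
        ≤ ∫⁻ _ in parabolicCylinder R z, ENNReal.ofReal P ^ (3 / 2 : ℝ) := by
          refine setLIntegral_mono' (isOpen_parabolicCylinder R z).measurableSet fun w hw => ?_
          have hw' := mem_prod.1 (hsub hw)
          have hle : ‖p w.1 w.2‖ₑ ≤ ENNReal.ofReal P := by
            rw [← ofReal_norm, Real.norm_eq_abs]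
            exact ENNReal.ofReal_le_ofReal (hP w.1 hw'.1 w.2 hw'.2)
          exact ENNReal.rpow_le_rpow hle (by norm_num)
      _ = ENNReal.ofReal P ^ (3 / 2 : ℝ) * volume (parabolicCylinder R z) := setLIntegral_const _ _
      _ = _ := by rw [hvol]
  obtain ⟨V, hae, hVc, hVsm, -, hVb⟩ := hK₀ u p z hdist hbd hpm
  -- `u = V` on the open cylinder
  have hucont : ContinuousOn (uncurry u) (parabolicCylinder R z) :=
    hsol.smooth_velocity.continuousOn.mono hsub
  have hEq : EqOn (uncurry u) (uncurry V) (parabolicCylinder R z) :=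
    Measure.eqOn_open_of_ae_eq hae (isOpen_parabolicCylinder _ _) hucont hVc
  obtain ⟨ht1, ht2⟩ := ht
  have htx : ((t, x) : ℝ × EuclideanSpace ℝ (Fin 3)) ∈ parabolicCylinder (R / 2) z := by
    rw [mem_parabolicCylinder]
    simp only [hz, dist_self]
    exact ⟨⟨by linarith, ht2⟩, by positivity⟩
  have htxR : ((t, x) : ℝ × EuclideanSpace ℝ (Fin 3)) ∈ parabolicCylinder R z := by
    rw [mem_parabolicCylinder]
    simp only [hz, dist_self]
    exact ⟨⟨by nlinarith, ht2⟩, hR0⟩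
  have hslice : u t =ᶠ[𝓝 x] V t := by
    filter_upwards [ball_mem_nhds x hR0] with y hy
    have hmem : ((t, y) : ℝ × EuclideanSpace ℝ (Fin 3)) ∈ parabolicCylinder R z := by
      rw [mem_parabolicCylinder]
      simp only [hz]
      exact ⟨⟨by nlinarith, ht2⟩, mem_ball.1 hy⟩
    exact hEq hmem
  have hVdiff : DifferentiableAt ℝ (V t) x :=
    (hVsm (t, x) htxR).differentiableAt (by simp)
  refine ⟨hslice.differentiableAt_iff.2 hVdiff, ?_⟩
  rw [hslice.fderiv_eq, ← norm_iteratedFDeriv_one]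
  exact (hVb 1 le_rfl (t, x) htx).trans (le_max_left _ _)

set_option maxHeartbeats 800000 in
/-- **PF-b″ with uniform constants · `UnitFloatingSliceCore →` uniform terminal radius**: for `(r, a, M, P)` there are
`ρ, K, η > 0` such that for EVERY centre `x_c` and EVERY classical `(u,p)` on `(a,0) × B(x_c,4r)` with `‖u‖ ≤ M`, `|p| ≤ P`,
every slice `u(t)`, `t ∈ (−η, 0)`, extends holomorphically to the local complex tube over `B(x_c,2r)` of height `ρ` with the
bound `K` (`ρ = λ/(4C₀)`, `K/λ`, `η = 143λ²`, ONE scale `λ ≤ λ₀(r,a,M,P)`; proof = p624616 verbatim, constants first).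
[cite: BradshawGrujicKukavica2015, Thm. 2.3 (scaling covariance) and (4.9) p. 19; SereginSverak2009, §2 p. 8] -/
theorem exists_uniform_terminalRadius_of_unitFloatingSliceCore (h : UnitFloatingSliceCore) {r a M P : ℝ}
    (hr : 0 < r) (ha : a < 0) (hM0 : 0 ≤ M) (hP0 : 0 ≤ P) :
    ∃ ρ K η : ℝ, 0 < ρ ∧ 0 < K ∧ 0 < η ∧
      ∀ (xc : EuclideanSpace ℝ (Fin 3)) (u : ℝ → EuclideanSpace ℝ (Fin 3) → EuclideanSpace ℝ (Fin 3))
        (p : ℝ → EuclideanSpace ℝ (Fin 3) → ℝ),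
        IsClassicalNSSolutionOnRegion (Ioo a 0 ×ˢ ball xc (4 * r)) 1 0 u p →
        (∀ t ∈ Ioo a 0, ∀ x ∈ ball xc (4 * r), ‖u t x‖ ≤ M) →
        (∀ t ∈ Ioo a 0, ∀ x ∈ ball xc (4 * r), |p t x| ≤ P) →
        ∀ t ∈ Ioo (-η) 0, ∃ U : EuclideanSpace ℂ (Fin 3) → EuclideanSpace ℂ (Fin 3),
          DifferentiableOn ℂ U (localComplexTube xc (2 * r) ρ) ∧
          (∀ z ∈ localComplexTube xc (2 * r) ρ, ‖U z‖ ≤ K) ∧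
          ∀ x ∈ ball xc (2 * r), U (complexify x) = complexify (u t x) := by
  obtain ⟨ε₀, C₀, K, hε₀, hC₀, hK, hcore⟩ := h
  obtain ⟨R₁, K₁, hR₁, hR₁a, hK₁, hgradU⟩ := exists_fderiv_bound_near_top_uniform M P hr ha
  -- the volume of the ball of radius `12`
  set v : ℝ := (volume (ball (0 : EuclideanSpace ℝ (Fin 3)) 12)).toReal with hv_def
  have hv0 : 0 ≤ v := ENNReal.toReal_nonneg
  have hvol12 : ∀ y₁ : EuclideanSpace ℝ (Fin 3),
      volume.restrict (ball y₁ 12) univ = ENNReal.ofReal v := by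
    intro y₁
    rw [Measure.restrict_apply_univ, Measure.addHaar_ball_center, hv_def,
      ENNReal.ofReal_toReal measure_ball_lt_top.ne]
  -- ### the scale `λ`
  set B : ℝ := v ^ (3 : ℝ)⁻¹ * M + v ^ (3 / 2 : ℝ)⁻¹ * P + 432 * v * K₁ ^ 2 + 1 with hB_def
  have hB0 : 0 < B := by positivity
  set lam : ℝ := min (r / 12) (min (R₁ / 13) (min 1 (min ε₀ (ε₀ / B)))) with hlam_def
  have hlam0 : 0 < lam := lt_min (by positivity) (lt_min (by positivity)
    (lt_min one_pos (lt_min hε₀ (by positivity))))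
  have hlam_r : 12 * lam ≤ r := by
    have : lam ≤ r / 12 := min_le_left _ _
    linarith
  have hlam_R : 145 * lam ^ 2 ≤ R₁ ^ 2 := by
    have h1 : lam ≤ R₁ / 13 := (min_le_right _ _).trans (min_le_left _ _)
    nlinarith [hlam0.le]
  have hlam1 : lam ≤ 1 := ((min_le_right _ _).trans (min_le_right _ _)).trans (min_le_left _ _)
  have hlamε : lam ≤ ε₀ :=
    (((min_le_right _ _).trans (min_le_right _ _)).trans (min_le_right _ _)).trans (min_le_left _ _)
  have hlamB : lam * B ≤ ε₀ := by
    have : lam ≤ ε₀ / B :=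
      (((min_le_right _ _).trans (min_le_right _ _)).trans (min_le_right _ _)).trans (min_le_right _ _)
    rwa [le_div_iff₀ hB0] at this
  have hlam2 : lam ^ 2 ≤ lam := by nlinarith
  refine ⟨lam * (1 / (4 * C₀)), K / lam, 143 * lam ^ 2, by positivity, by positivity, by positivity, ?_⟩
  intro xc u p hsol hM hP t ht
  have hgrad := hgradU xc u p hsol hM hP
  have hO : IsOpen (Ioo a 0 ×ˢ ball xc (4 * r)) := isOpen_Ioo.prod isOpen_ball
  -- ### the rescaled pair
  set t₀ : ℝ := -(144 * lam ^ 2) with ht₀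
  set V : ℝ → EuclideanSpace ℝ (Fin 3) → EuclideanSpace ℝ (Fin 3) :=
    lam • stPull (lam ^ 2) lam t₀ xc u with hV
  set Q : ℝ → EuclideanSpace ℝ (Fin 3) → ℝ := (lam ^ 2) • stPull (lam ^ 2) lam t₀ xc p with hQ
  have hVapp : ∀ s y, V s y = lam • u (t₀ + lam ^ 2 * s) (xc + lam • y) := fun s y => by
    simp [hV, stPull_apply]
  have hQapp : ∀ s y, Q s y = (lam ^ 2) • p (t₀ + lam ^ 2 * s) (xc + lam • y) := fun s y => by
    simp [hQ, stPull_apply]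
  have hres : IsClassicalNSSolutionOnRegion (stAffine (lam ^ 2) lam t₀ xc ⁻¹' (Ioo a 0 ×ˢ ball xc (4 * r)))
      1 ((lam ^ 2 * lam) • stPull (lam ^ 2) lam t₀ xc 0) V Q :=
    hsol.nsRescale_translate_of_isOpen hO hlam0 t₀ xc
  -- physical points of the unit cylinders over centres `y₁ ∈ B(0, 2r/λ)`
  have hphys : ∀ y₁ ∈ ball (0 : EuclideanSpace ℝ (Fin 3)) (2 * r / lam),
      ∀ s ∈ Ioo (-1 : ℝ) ((12 : ℝ) ^ 2), ∀ y ∈ ball y₁ 12,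
        t₀ + lam ^ 2 * s ∈ Ioo (-R₁ ^ 2) 0 ∧ xc + lam • y ∈ ball xc (3 * r) := by
    intro y₁ hy₁ s hs y hy
    obtain ⟨hs1, hs2⟩ := hs
    refine ⟨⟨?_, ?_⟩, ?_⟩
    · have : -(145 * lam ^ 2) < t₀ + lam ^ 2 * s := by rw [ht₀]; nlinarith [pow_pos hlam0 2]
      linarith
    · rw [ht₀]; nlinarith [pow_pos hlam0 2]
    · rw [mem_ball, dist_eq_norm, add_sub_cancel_left, norm_smul, Real.norm_eq_abs, abs_of_pos hlam0]
      rw [mem_ball, dist_zero_right, lt_div_iff₀ hlam0] at hy₁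
      rw [mem_ball, dist_eq_norm] at hy
      have : ‖y‖ ≤ ‖y - y₁‖ + ‖y₁‖ := norm_le_norm_sub_add y y₁  -- check name
      nlinarith [norm_nonneg y₁]
  have hIoo : Ioo (-R₁ ^ 2) 0 ⊆ Ioo a 0 := Ioo_subset_Ioo_left (by linarith)
  have hball3 : ball xc (3 * r) ⊆ ball xc (4 * r) := ball_subset_ball (by linarith)
  -- the unit cylinders lie in the preimage of the region
  have hcyl : ∀ y₁ ∈ ball (0 : EuclideanSpace ℝ (Fin 3)) (2 * r / lam),
      Ioo (-1 : ℝ) ((12 : ℝ) ^ 2) ×ˢ ball y₁ 12 ⊆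
        stAffine (lam ^ 2) lam t₀ xc ⁻¹' (Ioo a 0 ×ˢ ball xc (4 * r)) := by
    intro y₁ hy₁ w hw
    obtain ⟨hs, hy⟩ := mem_prod.1 hw
    obtain ⟨h1, h2⟩ := hphys y₁ hy₁ w.1 hs w.2 hy
    rw [mem_preimage, stAffine_apply]
    exact mk_mem_prod (hIoo h1) (hball3 h2)
  -- ### the unit-core data over every unit centre
  have hunit : ∀ y₁ ∈ ball (0 : EuclideanSpace ℝ (Fin 3)) (2 * r / lam), ∀ s ∈ Ico (1 : ℝ) ((12 : ℝ) ^ 2),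
      ∃ U : EuclideanSpace ℂ (Fin 3) → EuclideanSpace ℂ (Fin 3),
        DifferentiableOn ℂ U (localComplexTube y₁ 1 (1 / (4 * C₀))) ∧
        (∀ z ∈ localComplexTube y₁ 1 (1 / (4 * C₀)), ‖U z‖ ≤ K) ∧
        ∀ x ∈ ball y₁ 1, U (complexify x) = complexify (V s x) := by
    intro y₁ hy₁
    have hopen : IsOpen (Ioo (-1 : ℝ) ((12 : ℝ) ^ 2) ×ˢ ball y₁ 12) := isOpen_Ioo.prod isOpen_ball
    obtain ⟨hVs, hQs, hmom, hdiv⟩ := (isClassicalNSSolutionOnRegion_iff_of_isOpen hopen).1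
      (hres.mono_of_isOpen (hcyl y₁ hy₁) hopen)
    refine hcore y₁ one_pos hVs hQs (fun s hs y hy => ?_) (fun s hs y hy => hdiv s y ⟨hs, hy⟩)
      (fun s hs => ?_) (fun s hs => ?_) ?_
    · -- the equations (force `0`, `ν = 1`)
      have := hmom s y ⟨hs, hy⟩
      simpa only [one_smul, Pi.smul_apply, stPull_apply, Pi.zero_apply, smul_zero, add_zero] using this
    · -- `L³` smallness of the velocity
      have hb : ∀ᵐ y ∂(volume.restrict (ball y₁ 12)), ‖V s y‖ ≤ lam * M := by
        refine (ae_restrict_iff' measurableSet_ball).2 (Eventually.of_forall fun y hy => ?_)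
        obtain ⟨h1, h2⟩ := hphys y₁ hy₁ s hs y hy
        rw [hVapp, norm_smul, Real.norm_eq_abs, abs_of_pos hlam0]
        exact mul_le_mul_of_nonneg_left (hM _ (hIoo h1) _ (hball3 h2)) hlam0.le
      refine (eLpNorm_le_of_ae_bound hb).trans ?_
      rw [hvol12, ENNReal.toReal_ofNat, ENNReal.ofReal_rpow_of_nonneg hv0 (by positivity),
        ← ENNReal.ofReal_mul (by positivity)]
      refine ENNReal.ofReal_le_ofReal ?_
      calc v ^ (3 : ℝ)⁻¹ * (lam * M) = lam * (v ^ (3 : ℝ)⁻¹ * M) := by ring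
        _ ≤ lam * B := by
            refine mul_le_mul_of_nonneg_left ?_ hlam0.le
            rw [hB_def]; nlinarith [Real.rpow_nonneg hv0 (3 / 2 : ℝ)⁻¹, sq_nonneg K₁,
              mul_nonneg (Real.rpow_nonneg hv0 (3 / 2 : ℝ)⁻¹) hP0, mul_nonneg hv0 (sq_nonneg K₁)]
        _ ≤ ε₀ := hlamB
    · -- `L^{3/2}` smallness of the pressure
      have hb : ∀ᵐ y ∂(volume.restrict (ball y₁ 12)), ‖Q s y‖ ≤ lam * P := by
        refine (ae_restrict_iff' measurableSet_ball).2 (Eventually.of_forall fun y hy => ?_)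
        obtain ⟨h1, h2⟩ := hphys y₁ hy₁ s hs y hy
        rw [hQapp, smul_eq_mul, norm_mul, Real.norm_eq_abs, abs_of_pos (pow_pos hlam0 2),
          Real.norm_eq_abs]
        calc lam ^ 2 * |p (t₀ + lam ^ 2 * s) (xc + lam • y)| ≤ lam ^ 2 * P :=
              mul_le_mul_of_nonneg_left (hP _ (hIoo h1) _ (hball3 h2)) (pow_pos hlam0 2).le
          _ ≤ lam * P := mul_le_mul_of_nonneg_right hlam2 hP0
      refine (eLpNorm_le_of_ae_bound hb).trans ?_
      rw [hvol12, ENNReal.toReal_ofReal (by norm_num : (0 : ℝ) ≤ 3 / 2),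
        ENNReal.ofReal_rpow_of_nonneg hv0 (by positivity), ← ENNReal.ofReal_mul (by positivity)]
      refine ENNReal.ofReal_le_ofReal ?_
      calc v ^ (3 / 2 : ℝ)⁻¹ * (lam * P) = lam * (v ^ (3 / 2 : ℝ)⁻¹ * P) := by ring
        _ ≤ lam * B := by
            refine mul_le_mul_of_nonneg_left ?_ hlam0.le
            rw [hB_def]; nlinarith [Real.rpow_nonneg hv0 (3 : ℝ)⁻¹, sq_nonneg K₁,
              mul_nonneg (Real.rpow_nonneg hv0 (3 : ℝ)⁻¹) hM0, mul_nonneg hv0 (sq_nonneg K₁)]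
        _ ≤ ε₀ := hlamB
    · -- gradient smallness
      set Cg : ℝ := Real.sqrt 3 * (lam ^ 2 * K₁) with hCg
      have hCg0 : 0 ≤ Cg := by positivity
      have hslice : ∀ s ∈ Ioo (0 : ℝ) ((12 : ℝ) ^ 2),
          eLpNorm (fun x => Real.sqrt (frobeniusNormSq (fderiv ℝ (V s) x))) 2
              (volume.restrict (ball y₁ 12)) ^ (2 : ℝ) ≤ ENNReal.ofReal (v * Cg ^ 2) := by
        intro s hs
        have hs' : s ∈ Ioo (-1 : ℝ) ((12 : ℝ) ^ 2) := ⟨by linarith [hs.1], hs.2⟩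
        have hb : ∀ᵐ y ∂(volume.restrict (ball y₁ 12)),
            ‖Real.sqrt (frobeniusNormSq (fderiv ℝ (V s) y))‖ ≤ Cg := by
          refine (ae_restrict_iff' measurableSet_ball).2 (Eventually.of_forall fun y hy => ?_)
          obtain ⟨h1, h2⟩ := hphys y₁ hy₁ s hs' y hy
          obtain ⟨hdiff, hK⟩ := hgrad _ h1 _ h2
          -- the derivative of the rescaled slice
          have hd : DifferentiableAt ℝ (stPull (lam ^ 2) lam t₀ xc u s) y := by
            have : stPull (lam ^ 2) lam t₀ xc u s =
                u (t₀ + lam ^ 2 * s) ∘ fun z : EuclideanSpace ℝ (Fin 3) => xc + lam • z := by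
              funext z; rfl
            rw [this]
            exact hdiff.comp y ((differentiableAt_const _).add (differentiableAt_id.const_smul lam))
          have hfd : fderiv ℝ (V s) y = (lam * lam) • fderiv ℝ (u (t₀ + lam ^ 2 * s)) (xc + lam • y) := by
            rw [show V s = fun z => lam • stPull (lam ^ 2) lam t₀ xc u s z from rfl,
              fderiv_fun_const_smul hd, fderiv_stPull, smul_smul]
          have hnorm : ‖fderiv ℝ (V s) y‖ ≤ lam ^ 2 * K₁ := by
            rw [hfd, norm_smul, Real.norm_eq_abs, abs_of_pos (mul_pos hlam0 hlam0), ← sq]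
            exact mul_le_mul_of_nonneg_left hK (pow_pos hlam0 2).le
          rw [Real.norm_eq_abs, abs_of_nonneg (Real.sqrt_nonneg _), hCg,
            show Real.sqrt 3 * (lam ^ 2 * K₁) = Real.sqrt (3 * (lam ^ 2 * K₁) ^ 2) by
              rw [Real.sqrt_mul (by norm_num), Real.sqrt_sq (by positivity)]]
          refine Real.sqrt_le_sqrt ((BradshawTsai2017.frobeniusNormSq_le_three_mul_norm_sq _).trans ?_)
          exact mul_le_mul_of_nonneg_left (pow_le_pow_left₀ (norm_nonneg _) hnorm 2) (by norm_num)
        have h1 := eLpNorm_le_of_ae_bound (p := 2) hb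
        rw [hvol12, ENNReal.toReal_ofNat] at h1
        calc eLpNorm (fun x => Real.sqrt (frobeniusNormSq (fderiv ℝ (V s) x))) 2
                (volume.restrict (ball y₁ 12)) ^ (2 : ℝ)
            ≤ (ENNReal.ofReal v ^ (2 : ℝ)⁻¹ * ENNReal.ofReal Cg) ^ (2 : ℝ) :=
              ENNReal.rpow_le_rpow h1 (by norm_num)
          _ = ENNReal.ofReal (v * Cg ^ 2) := by
              rw [ENNReal.mul_rpow_of_nonneg _ _ (by norm_num : (0 : ℝ) ≤ 2), ← ENNReal.rpow_mul,
                inv_mul_cancel₀ (two_ne_zero), ENNReal.rpow_one,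
                ENNReal.ofReal_rpow_of_nonneg hCg0 (by norm_num), Real.rpow_two,
                ← ENNReal.ofReal_mul hv0]
      calc ∫⁻ s in Ioo (0 : ℝ) ((12 : ℝ) ^ 2),
            eLpNorm (fun x => Real.sqrt (frobeniusNormSq (fderiv ℝ (V s) x))) 2
              (volume.restrict (ball y₁ 12)) ^ (2 : ℝ)
          ≤ ∫⁻ _ in Ioo (0 : ℝ) ((12 : ℝ) ^ 2), ENNReal.ofReal (v * Cg ^ 2) :=
            setLIntegral_mono' measurableSet_Ioo hslice
        _ = ENNReal.ofReal (v * Cg ^ 2) * ENNReal.ofReal ((12 : ℝ) ^ 2) := by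
            rw [setLIntegral_const, Real.volume_Ioo, sub_zero]
        _ = ENNReal.ofReal (v * Cg ^ 2 * (12 : ℝ) ^ 2) := by
            rw [← ENNReal.ofReal_mul (by positivity)]
        _ ≤ ENNReal.ofReal (ε₀ ^ 2) := by
            refine ENNReal.ofReal_le_ofReal ?_
            have hsq : Real.sqrt 3 ^ 2 = 3 := Real.sq_sqrt (by norm_num)
            have hlam4 : lam ^ 4 ≤ lam ^ 2 := by nlinarith [pow_pos hlam0 2]
            calc v * Cg ^ 2 * (12 : ℝ) ^ 2 = 432 * v * K₁ ^ 2 * lam ^ 4 := by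
                  rw [hCg, mul_pow, hsq]; ring
              _ ≤ 432 * v * K₁ ^ 2 * lam ^ 2 :=
                  mul_le_mul_of_nonneg_left hlam4 (by positivity)
              _ = lam * ((432 * v * K₁ ^ 2) * lam) := by ring
              _ ≤ lam * (B * lam) := by
                  refine mul_le_mul_of_nonneg_left (mul_le_mul_of_nonneg_right ?_ hlam0.le) hlam0.le
                  rw [hB_def]
                  nlinarith [mul_nonneg (Real.rpow_nonneg hv0 (3 : ℝ)⁻¹) hM0,
                    mul_nonneg (Real.rpow_nonneg hv0 (3 / 2 : ℝ)⁻¹) hP0]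
              _ ≤ ε₀ * ε₀ := by
                  rw [mul_comm B lam]
                  exact mul_le_mul hlamε hlamB (by positivity) hε₀.le
              _ = ε₀ ^ 2 := (sq ε₀).symm
  -- ### conclusion at the slice `t`: `ρ = λ/(4C₀)`, bound `K/λ`
  obtain ⟨ht1, ht2⟩ := ht
  -- the floating slice
  set s : ℝ := 144 + t / lam ^ 2 with hs_def
  have hl2 : 0 < lam ^ 2 := pow_pos hlam0 2
  have hs : s ∈ Ico (1 : ℝ) ((12 : ℝ) ^ 2) := by
    refine ⟨?_, ?_⟩
    · rw [hs_def]
      have : -143 < t / lam ^ 2 := by rw [lt_div_iff₀ hl2]; linarith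
      linarith
    · rw [hs_def]
      have : t / lam ^ 2 < 0 := div_neg_of_neg_of_pos ht2 hl2
      nlinarith
  have hts : t₀ + lam ^ 2 * s = t := by
    rw [ht₀, hs_def]; field_simp; ring
  -- glue over `B(0, 2r/λ)` with the bound
  obtain ⟨U', hU'd, hU'b, hU'g⟩ :=
    exists_differentiableOn_localComplexTube_of_forall_unit_ball_norm_le
      (xc := (0 : EuclideanSpace ℝ (Fin 3))) (R := 2 * r / lam) (h := 1 / (4 * C₀)) (K := K)
      (f := V s) fun y₁ hy₁ => hunit y₁ hy₁ s hs
  -- transport back to `u t` over `B(x_c, 2r)`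
  have hU'g' : ∀ y ∈ ball (0 : EuclideanSpace ℝ (Fin 3)) (2 * r / lam),
      U' (complexify y) = complexify (lam • u t (xc + lam • y)) := by
    intro y hy
    rw [hU'g y hy, hVapp, hts]
  exact exists_extension_of_rescaled_norm_le hlam0 hU'd hU'b hU'g'

/-- **Uniform terminal radius HOLDS** (PF-b′ `unitFloatingSliceCore_holds`, ns-s29-p2 g3, + the uniform PF-b″ above): the
constants `(ρ, K, η)` of LEG F's tube extension depend on `(r, a, M, P)` only — the form consumed by door S32's plate F32.
[cite: BradshawGrujicKukavica2015, Thm. 2.3 and (4.9) p. 19] -/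
theorem exists_uniform_terminalRadius {r a M P : ℝ} (hr : 0 < r) (ha : a < 0) (hM0 : 0 ≤ M) (hP0 : 0 ≤ P) :
    ∃ ρ K η : ℝ, 0 < ρ ∧ 0 < K ∧ 0 < η ∧
      ∀ (xc : EuclideanSpace ℝ (Fin 3)) (u : ℝ → EuclideanSpace ℝ (Fin 3) → EuclideanSpace ℝ (Fin 3))
        (p : ℝ → EuclideanSpace ℝ (Fin 3) → ℝ),
        IsClassicalNSSolutionOnRegion (Ioo a 0 ×ˢ ball xc (4 * r)) 1 0 u p →
        (∀ t ∈ Ioo a 0, ∀ x ∈ ball xc (4 * r), ‖u t x‖ ≤ M) →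
        (∀ t ∈ Ioo a 0, ∀ x ∈ ball xc (4 * r), |p t x| ≤ P) →
        ∀ t ∈ Ioo (-η) 0, ∃ U : EuclideanSpace ℂ (Fin 3) → EuclideanSpace ℂ (Fin 3),
          DifferentiableOn ℂ U (localComplexTube xc (2 * r) ρ) ∧
          (∀ z ∈ localComplexTube xc (2 * r) ρ, ‖U z‖ ≤ K) ∧
          ∀ x ∈ ball xc (2 * r), U (complexify x) = complexify (u t x) :=
  exists_uniform_terminalRadius_of_unitFloatingSliceCore unitFloatingSliceCore_holds hr ha hM0 hP0

end Summit.NavierStokesRegularity.NavierStokesRegularity.Theorems.QuietScarPocketDoor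

end
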